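import Literature.AlgebraicGeometry.Resolution.QuadraticTransforms
import Mathlib.RingTheory.Derivation.Basic
import Mathlib.Algebra.CharP.Lemmas
import Mathlib.RingTheory.IntegralClosure.IsIntegralClosure.Basic
import Mathlib.Algebra.Order.GroupWithZero.Basic

/-!
# Approximation rounds for `α_p`-torsors along a discrete rank-one valuation (E1, layer L4)

Helper file for the line `pfaff-line-log-final-forms` of the crux `Valuative.LuAlphaPTorsor`
(item `stmt-ResolutionOfSingularities-0641`), base dimension two, DISCRETE rank-one valuations
(registered helper stub `discreteSequence_rounds`).

Setting (all inside one field `K` of characteristic `p`): `R₀ → R₁ → ⋯` is the quadratic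
sequence of a two-dimensional regular local ring `R₀` of `K` along a valuation ring `O`
dominating it; `π ∈ 𝔪_O` generates the (discrete, rank one) value group; from the stage `i₀` on
the sequence is in the free `π`-chart regime (`π ∈ Rᵢ`, `z/π ∈ R_{i+1}` for every non-unit `z`
of `Rᵢ`); `D₀` is a derivation of `K` killing `π`, and `h i • D₀` maps `Rᵢ` into itself, with
`h (i+1) ∈ {h i, π h i}` (the derivation chain). Finally `a ∈ R_{i₀}` is not a `p`-th power and
`D₀ a ≠ 0`.

PROVED (`discreteSequence_rounds`), assuming the cleanness bound of layer L3 as a hypothesis: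
at some stage `i ≥ i₀` there are `c ∈ Rᵢ`, a unit `w` of `Rᵢ` and `n` with one of the exit data
(D) `a - c^p = π^{pn} w` and `h i • D₀ w` a unit; (R) `a - c^p = π^{pn} w` and the residue of `w`
not a `p`-th power; (T) `a - c^p = π^{pn+V} w` with `p ∤ V`; (T₀) a monomial form of `a`.

Proof. *Initial datum*: `v(a) = v(π)^N`, and a non-unit divided by `π` lies in the next ring,
so `a/π^N` is a unit of `R_{i₀+N}` (`div_pow_mem_of_valuation_eq`); if `p ∤ N` this is exit (T)
(with `c = 0`), otherwise `(i₀ + N, 0, N/p, a/π^N)` is a *clean datum*. *Round*: from a clean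
datum `(i, c, n, w)` put `s := ord_π v(h i • D₀ w)` (finite: `π^{pn} D₀ w = D₀ a ≠ 0` since
derivations kill `p`-th powers). If `h i • D₀ w` is a unit: exit (D). If the residue of `w` is
not a `p`-th power: exit (R). Otherwise `f := w - e^p` is a non-zero non-unit (`w` is not a
`p`-th power since `a` is not), `v(f) = v(π)^V`, `V ≥ 1`, `D₀ f = D₀ w`; the cleanness bound
gives a stage `i + j` where `f/π^V` is a unit and `h (i+j) = π^τ h i` with `V ≤ s + τ` and
`s + τ = V ∨ 2τ ≤ V + 1`. With `c' := c + π^n e` one has `a - c'^p = π^{pn+V} (f/π^V)`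
(Frobenius): exit (T) if `p ∤ V`, and otherwise a new clean datum whose invariant
`s' = s + τ - V` is `< s` (as `V ≥ p ≥ 2` and `s ≥ 1`). *Termination*: strong induction on `s`.
[folklore] (Giraud / Cossart–Piltant style differential invariants, here in the elementary
two-dimensional discrete case.)
-/

set_option linter.dupNamespace false

namespace Summit.ResolutionOfSingularities.ResolutionOfSingularities.Theorems.PfaffLine

open Literature.AlgebraicGeometry.Resolution

namespace DiscreteRounds

variable {K : Type} [Field K]

/-! ## Discrete values: natural exponents for elements of `O` -/

/-- If every non-zero value is an integral power of `v(π)`, `v(π) < 1`, then the value of a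
non-zero element of `O` is a natural power of `v(π)`. [folklore] -/
theorem exists_nat_of_valuation_le_one {O : ValuationSubring K} {π : K} (hπ0 : π ≠ 0)
    (hπ1 : O.valuation π < 1)
    (hdisc : ∀ z : K, z ≠ 0 → ∃ n : ℤ, O.valuation z = O.valuation π ^ n) {z : K}
    (hz : z ∈ O) (hz0 : z ≠ 0) : ∃ m : ℕ, O.valuation z = O.valuation π ^ m := by
  obtain ⟨n, hn⟩ := hdisc z hz0
  have hγpos : 0 < O.valuation π := (Valuation.pos_iff _).mpr hπ0
  have h1 : O.valuation z ≤ 1 := (O.valuation_le_one_iff z).mpr hz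
  rw [hn, zpow_le_one_iff_right_of_lt_one₀ hγpos hπ1] at h1
  refine ⟨n.toNat, ?_⟩
  rw [hn, ← zpow_natCast, Int.toNat_of_nonneg h1]

/-! ## Units of a dominated subring are the elements of value one -/

/-- In a subring `S` dominated by the valuation ring `O`, an element of value `1` is a unit.
[folklore] -/
theorem inv_mem_subring_of_valuation_eq_one {O : ValuationSubring K} {S : Subring K}
    (hS : SubringDominates S O.toSubring) {z : K} (hz : z ∈ S) (hv : O.valuation z = 1) :
    z⁻¹ ∈ S := by
  refine hS.2 z hz ?_
  show z⁻¹ ∈ O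
  rw [← O.valuation_le_one_iff, map_inv₀, hv, inv_one]

/-- A non-zero element of value `< 1` is not a unit of any subring of `O`. [folklore] -/
theorem inv_not_mem_subring_of_valuation_lt_one {O : ValuationSubring K} {S : Subring K}
    (hS : S ≤ O.toSubring) {z : K} (hz0 : z ≠ 0) (hv : O.valuation z < 1) : z⁻¹ ∉ S := by
  intro h
  have h1 : O.valuation z⁻¹ ≤ 1 := (O.valuation_le_one_iff _).mpr (hS h)
  rw [map_inv₀, inv_le_one₀ ((Valuation.pos_iff _).mpr hz0)] at h1
  exact not_lt.mpr h1 hv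

/-! ## Trivial cleanness: dividing out `π` along the free regime -/

/-- **Trivial cleanness.** In the free `π`-chart regime from stage `i₀` (every non-unit of `Rᵢ`
divided by `π` lies in `R_{i+1}`), an element `z ∈ Rᵢ` of value `v(π)^m` becomes `π^m` times a
unit `m` stages later: `z/π^m` is a unit of `R_{i+m}`. [folklore] -/
theorem div_pow_mem_of_valuation_eq {O : ValuationSubring K} {R : ℕ → Subring K} {π : K}
    {i₀ : ℕ} (hRO : ∀ n, SubringDominates (R n) O.toSubring) (hπ0 : π ≠ 0)
    (hπ1 : O.valuation π < 1)
    (hdiv : ∀ i, i₀ ≤ i → ∀ z : K, z ∈ R i → z⁻¹ ∉ R i → z / π ∈ R (i + 1)) :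
    ∀ (m i : ℕ) (z : K), i₀ ≤ i → z ∈ R i → O.valuation z = O.valuation π ^ m →
      z / π ^ m ∈ R (i + m) ∧ (z / π ^ m)⁻¹ ∈ R (i + m) := by
  intro m
  induction m with
  | zero =>
    intro i z _ hz hv
    rw [pow_zero] at hv
    rw [pow_zero, div_one, add_zero]
    exact ⟨hz, inv_mem_subring_of_valuation_eq_one (hRO i) hz hv⟩
  | succ m ih =>
    intro i z hi hz hv
    have hγ0 : O.valuation π ≠ 0 := (Valuation.ne_zero_iff _).mpr hπ0
    have hz0 : z ≠ 0 := by
      rintro rfl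
      rw [map_zero] at hv
      exact pow_ne_zero _ hγ0 hv.symm
    have hlt : O.valuation z < 1 := by
      rw [hv]
      exact pow_lt_one₀ zero_le hπ1 (Nat.succ_ne_zero m)
    have h1 : z / π ∈ R (i + 1) :=
      hdiv i hi z hz (inv_not_mem_subring_of_valuation_lt_one (hRO i).1 hz0 hlt)
    have hv1 : O.valuation (z / π) = O.valuation π ^ m := by
      rw [map_div₀, hv, pow_succ, mul_div_cancel_right₀ _ hγ0]
    obtain ⟨h2, h3⟩ := ih (i + 1) (z / π) (Nat.le_succ_of_le hi) h1 hv1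
    rw [show z / π ^ (m + 1) = z / π / π ^ m by rw [div_div, pow_succ'],
      show i + (m + 1) = i + 1 + m by omega]
    exact ⟨h2, h3⟩

/-! ## Derivations in characteristic `p` -/

/-- A derivation of a field of characteristic `p` kills `p`-th powers. [folklore] -/
theorem derivation_pow_char (p : ℕ) [Fact p.Prime] [CharP K p] (D : Derivation ℤ K K)
    (c : K) : D (c ^ p) = 0 := by
  rw [D.leibniz_pow, nsmul_eq_mul, CharP.cast_eq_zero, zero_mul]

/-- A derivation killing `π` kills its powers. [folklore] -/
theorem derivation_pow_eq_zero (D : Derivation ℤ K K) {π : K} (hπ : D π = 0) (m : ℕ) :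
    D (π ^ m) = 0 := by
  rw [D.leibniz_pow, hπ, smul_zero, smul_zero]

/-- Differentiating a clean datum: from `a - c^p = π^{pn} w` and `D π = 0` one gets
`π^{pn} D w = D a`. [folklore] -/
theorem derivation_clean (p : ℕ) [Fact p.Prime] [CharP K p] (D : Derivation ℤ K K)
    {π a c w : K} {n : ℕ} (hπ : D π = 0) (h : a - c ^ p = π ^ (p * n) * w) :
    π ^ (p * n) * D w = D a := by
  have h' := congrArg D h
  rw [map_sub, derivation_pow_char p D c, sub_zero, D.leibniz, derivation_pow_eq_zero D hπ,
    smul_zero, add_zero, smul_eq_mul] at h'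
  exact h'.symm

/-- Frobenius bookkeeping: from `a - c^p = π^{pn} w` one gets
`a - (c + π^n e)^p = π^{pn} (w - e^p)`. [folklore] -/
theorem sub_add_pow_char (p : ℕ) [Fact p.Prime] [CharP K p] {π a c w : K} (e : K) {n : ℕ}
    (h : a - c ^ p = π ^ (p * n) * w) :
    a - (c + π ^ n * e) ^ p = π ^ (p * n) * (w - e ^ p) := by
  rw [add_pow_char, mul_pow, ← pow_mul, show n * p = p * n from Nat.mul_comm n p]
  linear_combination h

end DiscreteRounds

open DiscreteRounds in
/-- **E1, layer L4: the approximation rounds.** Along the quadratic sequence of a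
two-dimensional regular local ring of a field `K` of characteristic `p` along a discrete
rank-one valuation ring `O` (`v(π)` generating the value group), in the free `π`-chart regime
from stage `i₀` with a derivation chain `h i • D₀` (`D₀ π = 0`), and assuming the cleanness
bound of layer L3 (first hypothesis), every `a ∈ R_{i₀}` which is not a `p`-th power and has
`D₀ a ≠ 0` reaches, at some stage `i ≥ i₀`, one of the four exit data (D), (R), (T), (T₀)
described in the module docstring. Proof: initial clean datum by trivial cleanness, then rounds
`(i, c, n, w) ↦ (i + j, c + π^n e, n + V/p, (w - e^p)/π^V)` strictly decreasing the invariant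
`s = ord_π v(h i • D₀ w)` unless an exit fires; strong induction on `s`. [folklore] -/
theorem discreteSequence_rounds :
    (∀ (K' : Type) [Field K'] (O' : ValuationSubring K') (R : ℕ → Subring K') (π : K') (i₀ : ℕ) (y : ℕ → K') (D₀ : Derivation ℤ K' K') (h : ℕ → K'), IsRegularLocalRing (R 0) → ringKrullDim (R 0) = 2 → Literature.AlgebraicGeometry.Resolution.IsLocalRingOf (R 0) → Literature.AlgebraicGeometry.Resolution.SubringDominates (R 0) O'.toSubring → (∀ i, Literature.AlgebraicGeometry.Resolution.IsQuadraticTransformAlong O' (R i) (R (i + 1))) → π ≠ 0 → O'.valuation π < 1 → (∀ z : K', z ≠ 0 → ∃ n : ℤ, O'.valuation z = O'.valuation π ^ n) → (∀ i : ℕ, i₀ ≤ i → π ∈ R i ∧ (∀ z : K', z ∈ R i → z⁻¹ ∉ R i → z / π ∈ R (i + 1)) ∧ (y i ∈ R i ∧ (y i)⁻¹ ∉ R i ∧ ∀ z : K', z ∈ R i → z⁻¹ ∉ R i → ∃ a ∈ R i, ∃ b ∈ R i, z = a * π + b * y i)) → D₀ π = 0 → (∀ i : ℕ, i₀ ≤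 i → h i ≠ 0 ∧ h i ∈ R i ∧ (∀ z : K', z ∈ R i → h i * D₀ z ∈ R i) ∧ ((h i * D₀ (y i) ≠ 0 ∧ (h i * D₀ (y i))⁻¹ ∈ R i) → h (i + 1) = π * h i) ∧ (¬ (h i * D₀ (y i) ≠ 0 ∧ (h i * D₀ (y i))⁻¹ ∈ R i) → h (i + 1) = h i)) → ∀ (i : ℕ) (f : K') (V ν : ℕ), i₀ ≤ i → f ∈ R i → O'.valuation f = O'.valuation π ^ V → O'.valuation (h i * D₀ f) = O'.valuation π ^ ν → ∃ j τ : ℕ, f / π ^ V ∈ R (i + j) ∧ (f / π ^ V)⁻¹ ∈ R (i + j) ∧ h (i + j) = π ^ τ * h i ∧ V ≤ ν + τ ∧ (ν + τ = V ∨ 2 * τ ≤ V + 1)) → ∀ (K' : Type) [Field K'] (p : ℕ) [Fact p.Prime] [CharP K' p] (O' : ValuationSubring K') (R : ℕ → Subring K') (π : K') (i₀ : ℕ) (y : ℕ → K') (D₀ : Derivation ℤ K' K') (h : ℕ → K') (a : K'), IsRegularLocalRing (R 0) → ringKrullDim (R 0) = 2 → Literature.AlgebraicGeometry.Resolution.IsLocalRingOf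 (R 0) → Literature.AlgebraicGeometry.Resolution.SubringDominates (R 0) O'.toSubring → (∀ i, Literature.AlgebraicGeometry.Resolution.IsQuadraticTransformAlong O' (R i) (R (i + 1))) → (∀ (𝔮 : Ideal (R 0)) (L : Type) [Field L] [Algebra (R 0 ⧸ 𝔮) L] [IsFractionRing (R 0 ⧸ 𝔮) L], 𝔮.IsPrime → ringKrullDim (R 0 ⧸ 𝔮) = 1 → Module.Finite (R 0 ⧸ 𝔮) (integralClosure (R 0 ⧸ 𝔮) L)) → π ≠ 0 → O'.valuation π < 1 → (∀ z : K', z ≠ 0 → ∃ n : ℤ, O'.valuation z = O'.valuation π ^ n) → (∀ i : ℕ, i₀ ≤ i → π ∈ R i ∧ (∀ z : K', z ∈ R i → z⁻¹ ∉ R i → z / π ∈ R (i + 1)) ∧ (y i ∈ R i ∧ (y i)⁻¹ ∉ R i ∧ ∀ z : K', z ∈ R i → z⁻¹ ∉ R i → ∃ a ∈ R i, ∃ b ∈ R i, z = a * π + b * y i)) → D₀ π = 0 → (∀ i : ℕ, i₀ ≤ i → h i ≠ 0 ∧ h i ∈ R i ∧ (∀ z : K', z ∈ R i → h i * D₀ z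 ∈ R i) ∧ ((h i * D₀ (y i) ≠ 0 ∧ (h i * D₀ (y i))⁻¹ ∈ R i) → h (i + 1) = π * h i) ∧ (¬ (h i * D₀ (y i) ≠ 0 ∧ (h i * D₀ (y i))⁻¹ ∈ R i) → h (i + 1) = h i)) → a ∈ R i₀ → (∀ z : K', z ^ p ≠ a) → D₀ a ≠ 0 → ∃ (i : ℕ) (c w : K') (n : ℕ), i₀ ≤ i ∧ c ∈ R i ∧ w ∈ R i ∧ w⁻¹ ∈ R i ∧ w ≠ 0 ∧ ((a - c ^ p = π ^ (p * n) * w ∧ h i * D₀ w ≠ 0 ∧ (h i * D₀ w)⁻¹ ∈ R i) ∨ (a - c ^ p = π ^ (p * n) * w ∧ ∀ e : K', e ∈ R i → ¬ O'.valuation (w - e ^ p) < 1) ∨ (∃ V : ℕ, ¬ p ∣ V ∧ a - c ^ p = π ^ (p * n + V) * w) ∨ (∃ (d : ℕ) (u : Fin d → R i) (Mx : Fin d → ℕ), (∀ z : R i, z ∈ Ideal.span (Set.range u) ↔ ¬ IsUnit z) ∧ ringKrullDim (R i) = (d : WithBot ℕ∞) ∧ (∃ j, ¬ p ∣ Mx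 j) ∧ a = (Finset.univ.prod fun j => ((u j : R i) : K') ^ Mx j) * w)) := by
  intro hL3 K' _ p _ _ O' R π i₀ y D₀ h a hreg hdim hof hdom hstep _ hπ0 hπ1 hdisc hfree hDπ
    hchain haR hap hDa
  have hp : p.Prime := Fact.out
  -- every member of the sequence is dominated by `O'`, and the sequence is monotone
  have hRO : ∀ n, SubringDominates (R n) O'.toSubring := fun n =>
    (sequence_dominates hdom hstep n).1
  have hmono : Monotone R := sequence_monotone hstep
  have hdiv : ∀ i, i₀ ≤ i → ∀ z : K', z ∈ R i → z⁻¹ ∉ R i → z / π ∈ R (i + 1) := fun i hi =>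
    (hfree i hi).2.1
  have hγ0 : O'.valuation π ≠ 0 := (Valuation.ne_zero_iff _).mpr hπ0
  -- the cleanness bound of layer L3, specialised to the present data
  have hclean := hL3 K' O' R π i₀ y D₀ h hreg hdim hof hdom hstep hπ0 hπ1 hdisc hfree hDπ hchain
  clear hL3
  have ha0 : a ≠ 0 := fun h0 => hap 0 (by rw [zero_pow hp.ne_zero, h0])
  -- ### the rounds: strong induction on the invariant `s` of a clean datum `(i, c, n, w)`
  suffices key : ∀ (s : ℕ) (i : ℕ) (c w : K') (n : ℕ), i₀ ≤ i → c ∈ R i → w ∈ R i →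
      w⁻¹ ∈ R i → a - c ^ p = π ^ (p * n) * w →
      O'.valuation (h i * D₀ w) = O'.valuation π ^ s →
      ∃ (i : ℕ) (c w : K') (n : ℕ), i₀ ≤ i ∧ c ∈ R i ∧ w ∈ R i ∧ w⁻¹ ∈ R i ∧ w ≠ 0 ∧ ((a - c ^ p = π ^ (p * n) * w ∧ h i * D₀ w ≠ 0 ∧ (h i * D₀ w)⁻¹ ∈ R i) ∨ (a - c ^ p = π ^ (p * n) * w ∧ ∀ e : K', e ∈ R i → ¬ O'.valuation (w - e ^ p) < 1) ∨ (∃ V : ℕ, ¬ p ∣ V ∧ a - c ^ p = π ^ (p * n + V) * w) ∨ (∃ (d : ℕ) (u : Fin d → R i) (Mx : Fin d → ℕ), (∀ z : R i, z ∈ Ideal.span (Set.range u) ↔ ¬ IsUnit z) ∧ ringKrullDim (R i) = (d : WithBot ℕ∞) ∧ (∃ j, ¬ p ∣ Mx j) ∧ a = (Finset.univ.prod fun j => ((u j : R i) : K') ^ Mx j) * w)) by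
    -- ### the initial datum, by trivial cleanness
    have haO : a ∈ O' := (hRO i₀).1 haR
    obtain ⟨N, hN⟩ := exists_nat_of_valuation_le_one hπ0 hπ1 hdisc haO ha0
    obtain ⟨hw, hwi⟩ := div_pow_mem_of_valuation_eq hRO hπ0 hπ1 hdiv N i₀ a le_rfl haR hN
    by_cases hpN : p ∣ N
    · obtain ⟨n, rfl⟩ := hpN
      have hcw : a - 0 ^ p = π ^ (p * n) * (a / π ^ (p * n)) := by
        rw [zero_pow hp.ne_zero, sub_zero, mul_div_cancel₀ _ (pow_ne_zero _ hπ0)]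
      have hD := derivation_clean p D₀ hDπ hcw
      have hDw0 : D₀ (a / π ^ (p * n)) ≠ 0 := fun h0 => hDa (by rw [← hD, h0, mul_zero])
      have hci := hchain (i₀ + p * n) (Nat.le_add_right _ _)
      have hmem : h (i₀ + p * n) * D₀ (a / π ^ (p * n)) ∈ O' := (hRO _).1 (hci.2.2.1 _ hw)
      obtain ⟨s, hs⟩ :=
        exists_nat_of_valuation_le_one hπ0 hπ1 hdisc hmem (mul_ne_zero hci.1 hDw0)
      exact key s (i₀ + p * n) 0 (a / π ^ (p * n)) n (Nat.le_add_right _ _) (zero_mem _) hw hwi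
        hcw hs
    · refine ⟨i₀ + N, 0, a / π ^ N, 0, Nat.le_add_right _ _, zero_mem _, hw, hwi,
        div_ne_zero ha0 (pow_ne_zero N hπ0), Or.inr (Or.inr (Or.inl ⟨N, hpN, ?_⟩))⟩
      rw [zero_pow hp.ne_zero, sub_zero, mul_zero, zero_add, mul_div_cancel₀ _ (pow_ne_zero N hπ0)]
  intro s
  induction s using Nat.strong_induction_on with
  | _ s ih =>
  intro i c w n hi hc hw hwi hcw hs
  have hci := hchain i hi
  have hπR : π ∈ R i := (hfree i hi).1
  -- `w ≠ 0` and `D₀ w ≠ 0`, since `a` is not a `p`-th power and `D₀ a ≠ 0`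
  have hw0 : w ≠ 0 := by
    rintro rfl
    rw [mul_zero, sub_eq_zero] at hcw
    exact hap c hcw.symm
  have hD := derivation_clean p D₀ hDπ hcw
  have hDw0 : h i * D₀ w ≠ 0 :=
    mul_ne_zero hci.1 fun h0 => hDa (by rw [← hD, h0, mul_zero])
  -- exit (D): `h i • D₀ w` is a unit of `R i`
  by_cases hunit : (h i * D₀ w)⁻¹ ∈ R i
  · exact ⟨i, c, w, n, hi, hc, hw, hwi, hw0, Or.inl ⟨hcw, hDw0, hunit⟩⟩
  -- exit (R): the residue of `w` is not a `p`-th power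
  by_cases hres : ∀ e : K', e ∈ R i → ¬ O'.valuation (w - e ^ p) < 1
  · exact ⟨i, c, w, n, hi, hc, hw, hwi, hw0, Or.inr (Or.inl ⟨hcw, hres⟩)⟩
  -- otherwise improve the approximation: `f := w - e ^ p` is a non-zero non-unit of `R i`
  obtain ⟨e, he⟩ := not_forall.mp hres
  obtain ⟨heR, hlt⟩ := Classical.not_imp.mp he
  rw [not_not] at hlt
  have hs0 : s ≠ 0 := by
    rintro rfl
    rw [pow_zero] at hs
    exact hunit (inv_mem_subring_of_valuation_eq_one (hRO i) (hci.2.2.1 w hw) hs)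
  have hfR : w - e ^ p ∈ R i := sub_mem hw (pow_mem heR p)
  have hce := sub_add_pow_char p e hcw
  have hf0 : w - e ^ p ≠ 0 := by
    intro hf0
    rw [hf0, mul_zero, sub_eq_zero] at hce
    exact hap _ hce.symm
  obtain ⟨V, hV⟩ := exists_nat_of_valuation_le_one hπ0 hπ1 hdisc ((hRO i).1 hfR) hf0
  have hV0 : V ≠ 0 := by
    rintro rfl
    rw [hV, pow_zero] at hlt
    exact lt_irrefl _ hlt
  have hDf : D₀ (w - e ^ p) = D₀ w := by
    rw [map_sub, derivation_pow_char p D₀ e, sub_zero]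
  have hsf : O'.valuation (h i * D₀ (w - e ^ p)) = O'.valuation π ^ s := by rw [hDf, hs]
  -- the cleanness bound: `f / π ^ V` is a unit `j` stages later, `h (i + j) = π ^ τ * h i`
  obtain ⟨j, τ, hw', hw'i, hh, hVle, hor⟩ := hclean i (w - e ^ p) V s hi hfR hV hsf
  have hij : i₀ ≤ i + j := hi.trans (Nat.le_add_right i j)
  have hc' : c + π ^ n * e ∈ R (i + j) :=
    hmono (Nat.le_add_right i j) (add_mem hc (mul_mem (pow_mem hπR n) heR))
  have hw'0 : (w - e ^ p) / π ^ V ≠ 0 := div_ne_zero hf0 (pow_ne_zero V hπ0)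
  have hfe : π ^ V * ((w - e ^ p) / π ^ V) = w - e ^ p := mul_div_cancel₀ _ (pow_ne_zero V hπ0)
  have hce' : a - (c + π ^ n * e) ^ p = π ^ (p * n + V) * ((w - e ^ p) / π ^ V) := by
    rw [hce, pow_add, mul_assoc, hfe]
  by_cases hpV : p ∣ V
  swap
  -- exit (T): `p ∤ V`
  · exact ⟨i + j, c + π ^ n * e, (w - e ^ p) / π ^ V, n, hij, hc', hw', hw'i, hw'0,
      Or.inr (Or.inr (Or.inl ⟨V, hpV, hce'⟩))⟩
  -- `p ∣ V`: a new clean datum with a smaller invariant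
  obtain ⟨V', rfl⟩ := hpV
  have hV2 : 2 ≤ p * V' := hp.two_le.trans (Nat.le_of_dvd (Nat.pos_of_ne_zero hV0) ⟨V', rfl⟩)
  have hcw' : a - (c + π ^ n * e) ^ p = π ^ (p * (n + V')) * ((w - e ^ p) / π ^ (p * V')) := by
    rw [mul_add]; exact hce'
  -- the new invariant `s' = s + τ - p V'`
  have hDf' : D₀ (w - e ^ p) = π ^ (p * V') * D₀ ((w - e ^ p) / π ^ (p * V')) := by
    conv_lhs => rw [← hfe]
    rw [D₀.leibniz, derivation_pow_eq_zero D₀ hDπ, smul_zero, add_zero, smul_eq_mul]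
  have hX : π ^ (p * V') * (h (i + j) * D₀ ((w - e ^ p) / π ^ (p * V'))) =
      π ^ τ * (h i * D₀ w) := by
    rw [hh, ← hDf, hDf']; ring
  have hvX : O'.valuation π ^ (p * V') * O'.valuation (h (i + j) * D₀ ((w - e ^ p) / π ^ (p * V'))) =
      O'.valuation π ^ (p * V') * O'.valuation π ^ (s + τ - p * V') := by
    rw [← map_pow, ← map_mul, hX, map_mul, map_pow, hs, ← pow_add, map_pow, ← pow_add,
      show τ + s = p * V' + (s + τ - p * V') by omega]
  have hs' := mul_left_cancel₀ (pow_ne_zero _ hγ0) hvX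
  exact ih (s + τ - p * V') (by omega) (i + j) (c + π ^ n * e) ((w - e ^ p) / π ^ (p * V'))
    (n + V') hij hc' hw' hw'i hcw' hs'

end Summit.ResolutionOfSingularities.ResolutionOfSingularities.Theorems.PfaffLine
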